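import Literature.Barriers.CriticalPhenomena.SupercriticalSAWSpaceFillingSubcriticalLength
import Literature.Probability.RandomPlanarGeometry.SLEOnePointLowerEstimate
import Literature.Probability.RandomPlanarGeometry.RohdeSchrammCor35Proofs
import Literature.Probability.RandomPlanarGeometry.SAWBridgeRadius
import Mathlib.MeasureTheory.Function.StronglyMeasurable.Basic
import Mathlib.Analysis.SpecialFunctions.Pow.Asymptotics
import HarnessLib

/-!
# Barrier mechanism, fifth audit: the LEFT half of the fugacity axis — subcritical
# self-avoiding walks converge to no chordal SLE_κ (`0 < κ < 8`), so the SLE_{8/3}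
# identification pins the fugacity to `x_c = 1/μ(ℤ²)` EXACTLY

Barrier catalogue `Literature/Barriers/CriticalPhenomena/` (D-0021); fifth audit (2026-08-16,
refuter, "barrier-audit" gen 5) of the mechanism file `…Proofs` of `SupercriticalSAWSpaceFilling`
(= Theorem 1 of H. Duminil-Copin, G. Kozma, A. Yadin, *Supercritical self-avoiding walks are
space-filling*, Ann. IHP Probab. Stat. 50 (2014) 315–326, arXiv:1110.3074 — PROVED in the tree,
`SupercriticalSAWSpaceFilling_holds`; `blocks:` line `¬ RobustSAWScalingLimit` proved with no
hypothesis, `SupercriticalSAW.not_robustSAWScalingLimit`). The four earlier audits settled the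
RIGHT half of the fugacity axis completely — for every `x > x_c` the fugacity-`x` SAW converges to
no chordal SLE_κ with `0 < κ < 8` (`…BelowEight`), the mechanism is an equivalence on limit laws
(`…ProofsOnto`), an SLE_κ identification certifies `x ≤ x_c`
(`SupercriticalSAW.le_criticalFugacity_of_sawScalingLimitAt`) — and recorded ONE remaining formal
gap three times (`…ProofsNarrow` item 4, `…ProofsOnto` item 3, base block evasions (ix) and
`scope_caveats`): *LEFT classes `(x_c - ε, x_c]` are "dead in substance" (subcritical
Ornstein–Zernike picture [cite: BetzTaggi2019, §1]) "but refuted by no declaration of the tree"*.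
Outcome of this audit: **CONFIRMED at page level and STRENGTHENED — the left half is now a
theorem of the tree, by a mechanism that is the mirror image of the right half ("short ⇒ thin"
versus "supercritical ⇒ onto"), and the SLE_{8/3} identification pins the fugacity exactly:
`SAWScalingLimitAt x → x = x_c` for every `x > 0` (`eq_criticalFugacity_of_sawScalingLimitAt`,
axioms `propext`, `Classical.choice`, `Quot.sound`).**

## What the audit found

1. **Subcritical walks are short (lattice side, `…SubcriticalLength`).** For `0 < x < x_c` there
   is `C = C(x)` with `P_{(𝔻_δ,u_δ,v_δ,x)}[|γ_δ| > C/δ] → 0` for ANY endpoints `u_δ, v_δ ∈ 𝔻_δ`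
   (`tendsto_lawAt_length_lt_of_lt_criticalFugacity`): `Z ≥ x^{4/δ}` by one lattice path through
   the centre, and the walks of length `≥ N` weigh at most `Σ_{n≥N} cₙ xⁿ ≤ K ρᴺ/(1-ρ)`,
   `ρ = ρ(x) < 1`, because `cₙ wⁿ` is bounded for `w = (x + x_c)/2 < 1/μ` — `μ = inf cₙ^{1/n}` and
   `c_{n+m} ≤ cₙ cₘ` [cite: MadrasSlade1993, §1.2] (`Zd.exists_bound_count_mul_pow`, proved). So the
   polyline of `γ_δ` has macroscopic length `≤ C` and `ρ`-tube volume `≤ 9π(C+1)ρ`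
   (`volume_setOf_infDist_lt_le_of_length_le`) with probability `→ 1`.
2. **Thin limits (proved here).** The tube volume `c ↦ vol{w : dist(w, trace c) < ρ}` is lower
   semicontinuous on curve classes (`lowerSemicontinuous_measure_tube`), so "tube volume `≤ M`"
   is a closed condition; by the closed-set half of the portmanteau theorem
   [cite: Billingsley1999, Thm 2.1] (`ae_mem_of_tendstoLaw_of_isClosed`, by hand from `TendstoLaw`
   with the gap functional `min(1, dist(c, F))`) every limit in law of a short family is almost
   surely THIN: `vol{w : dist(w, trace Γ) < ρ} ≤ 9π(C+1)ρ` for all small `ρ`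
   (`ae_measure_tube_le_of_tendstoLaw`) — the mirror image of "limits of weakly space-filling
   families are ONTO" (`SupercriticalSAW.ae_subset_range_of_tendstoLaw`, `…ProofsNarrow`).
3. **SLE_κ, `0 < κ < 8`, is not thin (proved here from the tree's SLE theory).** Beffara's
   one-point LOWER estimate `P[dist(z, γ[0,∞)) ≤ ε] ≥ c₁ ε^{1-κ/8}` on compact sets of `ℍ`
   [cite: Beffara2008, Prop. 4] is a theorem of the tree (`exists_onePoint_lower_of_isCompact`,
   `SLEOnePointLowerEstimate.lean`; trace existence `hasSLETrace_of_ne_eight_apply`, Rohde–Schramm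
   Thm 5.1, proved). Transported through the uniformizing map `φ : ℍ → D` of `IsSLECurve` — which
   is Lipschitz near the compact set `φ⁻¹(B̄(w₀, r))` (`exists_lipschitz_near_of_conformalEquiv`:
   the derivative of a holomorphic map is continuous, hence bounded on a compact thickening) — it
   gives `P[dist(w, trace Γ) < ρ] ≥ c (ρ/L)^{1-κ/8}` uniformly on a closed ball `B̄(w₀, r) ⊆ D`
   (`exists_tube_lower_bound_of_isSLECurve`), and by Tonelli (`lintegral_measure_tube_eq`, joint
   measurability from `measurable_uncurry_of_continuous_of_measurable`)
   `E[vol(B̄ ∩ {dist(·, trace Γ) < ρ})] ≥ c (ρ/L)^{1-κ/8} π r²`. Against the thin bound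
   `≤ 9π(C+1)ρ` this forces `ρ^{-κ/8} ≤ A` for all small `ρ`, absurd
   (`not_convergesInLawToSLE_of_short`: a short family of finite SAW laws in ANY Dobrushin domain
   converges to no chordal SLE_κ, `0 < κ < 8`).
4. **The left half and the exact pinning (proved).** `not_convergesInLawToSLE_subcritical_unitDisc_of_lt_eight`
   (fugacity `0 < x < x_c`, unit disc, any endpoints in `𝔻_δ`, any `0 < κ < 8`),
   `not_sawScalingLimitAt_of_lt_criticalFugacity`, and with the right half
   (`not_sawScalingLimitAt_of_lt`, `…Unconditional`): `eq_criticalFugacity_of_sawScalingLimitAt`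
   (`0 < x`, `SAWScalingLimitAt x → x = x_c`), `sawScalingLimitAt_iff_of_pos`
   (`SAWScalingLimitAt x ↔ x = x_c ∧ SAWScalingLimit`), `not_sawScalingLimitAt_of_ne`, and
   `not_forall_Ioc_sawScalingLimitAt` (every LEFT class `(x_c - ε, x_c]` is refuted; with
   `not_forall_Ico_sawScalingLimitAt` of `…ProofsOnto` both one-sided classes are). So the
   technique class of the barrier is not "a neighbourhood of `x_c`" but "any fugacity other than
   the point `x_c`": an SLE_{8/3} (indeed any SLE_κ, `κ < 8`) identification of the curve-topology
   limit at an explicit fugacity `x > 0` is ipso facto the determination `μ(ℤ²) = 1/x` of the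
   connective constant, for which "no closed formula exists in general" (source, §1, p. 2).
5. **Confirmed (page level, arXiv text of the source).** p. 2, §1: "When `x < 1/μ`: `γ_δ`
   converges to a deterministic curve corresponding to the geodesic between `a` and `b` in `Ω`
   … should have Gaussian fluctuation of order `√δ` around the geodesic. The strong results of
   Ioffe on the unrestricted self-avoiding walk would be a central tool for proving such a
   statement, though we are not aware of a reference for the details"; "A phase transition occurs
   at the value `x_c = 1/μ`"; "When `x > 1/μ`: `γ_δ` is expected to become space-filling in the
   following sense …"; Theorem 1 verbatim. The geodesic picture itself is NOT what is proved here
   (only the length bound `|γ_δ| = O(1/δ)`, which suffices against every SLE_κ, `κ < 8`).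

## Formal content (all proved; one new closed `Prop`, `SupercriticalSAWSpaceFillingSubcritical`)

Portmanteau: `gapFunctional` (+ `_apply`, `_nonneg`, `_le_one`, `_eq_zero_of_mem`,
`mem_of_gapFunctional_eq_zero`), `integral_gapFunctional_comp_le`, `ae_mem_of_tendstoLaw_of_isClosed`.
Tubes: `lowerSemicontinuous_measure_tube`, `isClosed_setOf_measure_tube_le`,
`measurable_infDist_range_uncurry`, `lintegral_measure_tube_eq`. SLE side:
`exists_lipschitz_near_of_conformalEquiv`, `exists_tube_lower_bound_of_isSLECurve`. Assembly:
`ae_measure_tube_le_of_tendstoLaw`, `not_convergesInLawToSLE_of_short`,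
`not_convergesInLawToSLE_subcritical_unitDisc_of_lt_eight`,
`not_sawScalingLimitAt_of_lt_criticalFugacity`, `eq_criticalFugacity_of_sawScalingLimitAt`,
`sawScalingLimitAt_iff_of_pos`, `not_forall_Ioc_sawScalingLimitAt` (with `SAW.criticalFugacity_pos` of `SAWBridgeRadius.lean`),
`not_sawScalingLimitAt_of_ne`; the closed `Prop` `SupercriticalSAWSpaceFillingSubcritical` and
`SupercriticalSAWSpaceFillingSubcritical_holds`.

Mathlib: `BoundedContinuousFunction.mkOfBound`, `LowerSemicontinuous.isClosed_preimage`,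
`tendsto_measure_iUnion_atTop`, `measurable_uncurry_of_continuous_of_measurable`,
`MeasureTheory.Measure.prod_apply`, `MeasureTheory.Measure.prod_apply_symm`,
`Convex.norm_image_sub_le_of_norm_deriv_le`, `DifferentiableOn.contDiffOn`,
`ContDiffOn.continuousOn_deriv_of_isOpen`, `IsCompact.exists_cthickening_subset_open`,
`IsCompact.exists_bound_of_continuousOn`, `Complex.volume_closedBall`, `setLIntegral_mono'`,
`tendsto_rpow_neg_nhdsGT_zero`, `Real.rpow_sub_one`, `Real.div_rpow`.

## References (page-level, audit 2026-08-16; pages of the arXiv versions)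

* H. Duminil-Copin, G. Kozma, A. Yadin, Ann. IHP Probab. Stat. 50 (2014) 315–326,
  arXiv:1110.3074: p. 2 (§1: "no closed formula exists in general" for `μ`; the three
  phases — geodesic for `x < 1/μ`, "not aware of a reference for the details"; SLE_{8/3} at
  `x = 1/μ`; weak space-filling and SLE₈ for `x > 1/μ`; Theorem 1). [DuminilCopinKozmaYadin2014]
* N. Madras, G. Slade, *The Self-Avoiding Walk*, Birkhäuser (1993), §1.2 (submultiplicativity,
  `μ = lim cₙ^{1/n} = inf cₙ^{1/n}`). [MadrasSlade1993]
* V. Beffara, *The dimension of the SLE curves*, Ann. Probab. 36 (2008) 1421–1452, Prop. 4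
  (one-point estimate, lower half). [Beffara2008]
* S. Rohde, O. Schramm, *Basic properties of SLE*, Ann. of Math. 161 (2005), Thm 5.1 (the trace
  exists, `κ ≠ 8`). [RohdeSchramm2005]
* P. Billingsley, *Convergence of probability measures*, 2nd ed. (1999), Thm 2.1 (portmanteau,
  closed-set half). [Billingsley1999]
* V. Betz, L. Taggi, Electron. J. Probab. 24 (2019), arXiv:1612.07234, §1 (the subcritical
  straight-line / Brownian-bridge picture: Chayes–Chayes 1986, Ioffe 1998, Kovchegov 2002). [BetzTaggi2019]
-/

noncomputable section

open MeasureTheory Filter Topology Metric Set Literature.Probability.LatticeModels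
  Literature.Probability.Percolation Literature.Probability.RandomPlanarGeometry
  Literature.Probability.RandomPlanarGeometry.SAW
open UpperHalfPlane (upperHalfPlaneSet isOpen_upperHalfPlaneSet)
open scoped ENNReal NNReal BoundedContinuousFunction

namespace Literature.Barriers.CriticalPhenomena

namespace SupercriticalSAW

/-! ### Closed sets of curves and the closed-set half of the portmanteau theorem -/

section Portmanteau

variable {X : Type*} [MetricSpace X]

/-- The gap functional `h_F(c) = min 1 (dist(c, F))`: bounded (values in `[0, 1]`), continuous,
vanishing exactly on the closed set `F`. [folklore] -/
def gapFunctional (F : Set X) : X →ᵇ ℝ :=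
  BoundedContinuousFunction.mkOfBound ⟨fun c => min 1 (infDist c F),
    continuous_const.min (continuous_infDist_pt F)⟩ 1 fun c₁ c₂ => by
      simp only [ContinuousMap.coe_mk]
      rw [Real.dist_eq]
      have h₁ : 0 ≤ min 1 (infDist c₁ F) := le_min zero_le_one infDist_nonneg
      have h₂ : min 1 (infDist c₁ F) ≤ 1 := min_le_left _ _
      have h₃ : 0 ≤ min 1 (infDist c₂ F) := le_min zero_le_one infDist_nonneg
      have h₄ : min 1 (infDist c₂ F) ≤ 1 := min_le_left _ _
      rw [abs_le]; constructor <;> linarith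

/-- Value of the gap functional. [folklore] -/
theorem gapFunctional_apply (F : Set X) (c : X) : gapFunctional F c = min 1 (infDist c F) := rfl

/-- `0 ≤ h_F`. [folklore] -/
theorem gapFunctional_nonneg (F : Set X) (c : X) : 0 ≤ gapFunctional F c :=
  le_min zero_le_one infDist_nonneg

/-- `h_F ≤ 1`. [folklore] -/
theorem gapFunctional_le_one (F : Set X) (c : X) : gapFunctional F c ≤ 1 := min_le_left _ _

/-- `h_F = 0` on `F`. [folklore] -/
theorem gapFunctional_eq_zero_of_mem {F : Set X} {c : X} (hc : c ∈ F) : gapFunctional F c = 0 := by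
  rw [gapFunctional_apply, infDist_zero_of_mem hc, min_eq_right zero_le_one]

/-- For a nonempty closed `F`, `h_F(c) = 0` forces `c ∈ F`. [folklore] -/
theorem mem_of_gapFunctional_eq_zero {F : Set X} (hF : IsClosed F) (hne : F.Nonempty) {c : X}
    (h : gapFunctional F c = 0) : c ∈ F := by
  rw [gapFunctional_apply] at h
  have h0 : infDist c F = 0 := by
    rcases min_choice (1 : ℝ) (infDist c F) with h1 | h1
    · rw [h1] at h; exact absurd h one_ne_zero
    · rwa [h1] at h
  exact (hF.mem_iff_infDist_zero hne).2 h0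

variable {Ωδ : ℝ → Type*} [∀ δ, MeasurableSpace (Ωδ δ)] {Y : ∀ δ, Ωδ δ → X}
  {P : ∀ δ, Measure (Ωδ δ)} {Ω' : Type*} [MeasurableSpace Ω'] {W : Measure Ω'} {Z : Ω' → X}
  [MeasurableSpace X] [OpensMeasurableSpace X]

/-- Lattice side: `∫ h_F(Y) dP ≤ P[Y ∉ F]` for a finite measure `P` and measurable `Y`. [folklore] -/
theorem integral_gapFunctional_comp_le (μ : Measure Ω') [IsFiniteMeasure μ] {Y₀ : Ω' → X}
    (hY : Measurable Y₀) {F : Set X} (hF : IsClosed F) :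
    ∫ a, gapFunctional F (Y₀ a) ∂μ ≤ (μ {a | Y₀ a ∉ F}).toReal := by
  set S : Set Ω' := {a | Y₀ a ∉ F}
  have hS : MeasurableSet S := hY hF.measurableSet.compl
  rw [← measureReal_def, ← integral_indicator_one hS]
  refine integral_mono ?_ ((integrable_const (1 : ℝ)).indicator hS) fun a => ?_
  · exact Integrable.of_bound
      ((gapFunctional F).continuous.measurable.comp hY).aestronglyMeasurable 1
      (ae_of_all _ fun a => by
        rw [Real.norm_eq_abs, abs_of_nonneg (gapFunctional_nonneg _ _)]
        exact gapFunctional_le_one _ _)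
  · by_cases ha : a ∈ S
    · rw [indicator_of_mem ha, Pi.one_apply]
      exact gapFunctional_le_one _ _
    · rw [indicator_of_notMem ha]
      have ha' : Y₀ a ∈ F := by
        by_contra hcon
        exact ha hcon
      exact (gapFunctional_eq_zero_of_mem ha').le

/-- **Closed-set half of the portmanteau theorem, along `δ → 0⁺`.** If `Y δ → Z` in law
(bounded continuous test functions, finite laws `P δ`, finite `W`), the `Y δ` are measurable,
`F` is closed and `P δ [Y δ ∉ F] → 0`, then almost surely `Z ∈ F`: with the gap functional
`h_F`, `∫ h_F(Z) dW = lim ∫ h_F(Y δ) dP δ = 0`. [cite: Billingsley1999, Thm 2.1] -/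
theorem ae_mem_of_tendstoLaw_of_isClosed [∀ δ, IsFiniteMeasure (P δ)] [IsFiniteMeasure W]
    (hY : ∀ δ, Measurable (Y δ)) (hZ : AEMeasurable Z W) (hT : TendstoLaw Y P Z W)
    {F : Set X} (hF : IsClosed F)
    (hP : Tendsto (fun δ => P δ {ω | Y δ ω ∉ F}) (𝓝[>] 0) (𝓝 0)) :
    ∀ᵐ ω ∂W, Z ω ∈ F := by
  rcases F.eq_empty_or_nonempty with rfl | hne
  · -- `P δ (univ) → 0` forces `W = 0`
    have h1 : Tendsto (fun δ => ∫ ω, (1 : X →ᵇ ℝ) (Y δ ω) ∂P δ) (𝓝[>] (0 : ℝ))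
        (𝓝 (∫ ω, (1 : X →ᵇ ℝ) (Z ω) ∂W)) := hT 1
    simp only [BoundedContinuousFunction.coe_one, Pi.one_apply, integral_const, smul_eq_mul,
      mul_one] at h1
    have h2 : Tendsto (fun δ => (P δ).real univ) (𝓝[>] (0 : ℝ)) (𝓝 0) := by
      have h := (ENNReal.tendsto_toReal ENNReal.zero_ne_top).comp hP
      rw [ENNReal.toReal_zero] at h
      refine h.congr' (Eventually.of_forall fun δ => ?_)
      simp [measureReal_def]
    have h3 : W.real univ = 0 := tendsto_nhds_unique h1 h2
    have h4 : W = 0 := by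
      rw [← Measure.measure_univ_eq_zero]
      have := (measureReal_eq_zero_iff (measure_ne_top W univ)).1 h3
      exact this
    rw [h4]
    exact ae_zero.le (by simp)
  have hlim : Tendsto (fun δ => ∫ ω, gapFunctional F (Y δ ω) ∂P δ) (𝓝[>] (0 : ℝ))
      (𝓝 (∫ ω, gapFunctional F (Z ω) ∂W)) := hT (gapFunctional F)
  have hu : Tendsto (fun δ => (P δ {ω | Y δ ω ∉ F}).toReal) (𝓝[>] (0 : ℝ)) (𝓝 0) := by
    have h := (ENNReal.tendsto_toReal ENNReal.zero_ne_top).comp hP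
    rwa [ENNReal.toReal_zero] at h
  have hzero : Tendsto (fun δ => ∫ ω, gapFunctional F (Y δ ω) ∂P δ) (𝓝[>] (0 : ℝ)) (𝓝 0) :=
    tendsto_of_tendsto_of_tendsto_of_le_of_le tendsto_const_nhds hu
      (fun δ => integral_nonneg fun ω => gapFunctional_nonneg _ _)
      (fun δ => integral_gapFunctional_comp_le (P δ) (hY δ) hF)
  have hL : ∫ ω, gapFunctional F (Z ω) ∂W = 0 := tendsto_nhds_unique hlim hzero
  have hint : Integrable (fun ω => gapFunctional F (Z ω)) W :=
    Integrable.of_bound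
      ((gapFunctional F).continuous.measurable.comp_aemeasurable hZ).aestronglyMeasurable 1
      (ae_of_all _ fun ω => by
        rw [Real.norm_eq_abs, abs_of_nonneg (gapFunctional_nonneg _ _)]
        exact gapFunctional_le_one _ _)
  have hae : (fun ω => gapFunctional F (Z ω)) =ᵐ[W] 0 :=
    (integral_eq_zero_iff_of_nonneg_ae (ae_of_all _ fun ω => gapFunctional_nonneg _ _) hint).1 hL
  filter_upwards [hae] with ω hω
  exact mem_of_gapFunctional_eq_zero hF hne hω

end Portmanteau

/-! ### The tube volume is lower semicontinuous on curve classes -/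

section Tube

variable {E : Type*} [MetricSpace E] [MeasurableSpace E] (vol : Measure E)

/-- **Lower semicontinuity of the tube volume.** For a measure `vol` on `E` and `ρ`, the functional
`c ↦ vol{w : dist(w, trace c) < ρ}` on curve classes is lower semicontinuous: the open tube is the
increasing union of the tubes of radii `ρ - 1/(n+1)`, each of which is contained in the `ρ`-tube of
every curve class at distance `< 1/(n+1)` (`lipschitzWith_infDist_range`). [folklore] -/
theorem lowerSemicontinuous_measure_tube (ρ : ℝ) :
    LowerSemicontinuous fun c : CurveClass E => vol {w | infDist w c.range < ρ} := by
  intro c y hy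
  set s : ℕ → Set E := fun n => {w | infDist w c.range < ρ - 1 / ((n : ℝ) + 1)} with hs
  have hmono : Monotone s := by
    intro m n hmn w hw
    simp only [hs, mem_setOf_eq] at hw ⊢
    have : (1 : ℝ) / ((n : ℝ) + 1) ≤ 1 / ((m : ℝ) + 1) :=
      one_div_le_one_div_of_le (by positivity) (by exact_mod_cast Nat.succ_le_succ hmn)
    linarith
  have hU : {w | infDist w c.range < ρ} = ⋃ n, s n := by
    ext w
    simp only [mem_setOf_eq, mem_iUnion, hs]
    constructor
    · intro hw
      obtain ⟨n, hn⟩ := exists_nat_one_div_lt (sub_pos.2 hw)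
      exact ⟨n, by linarith⟩
    · rintro ⟨n, hn⟩
      have : (0 : ℝ) < 1 / ((n : ℝ) + 1) := by positivity
      linarith
  have hlim : Tendsto (vol ∘ s) atTop (𝓝 (vol {w | infDist w c.range < ρ})) := by
    rw [hU]; exact tendsto_measure_iUnion_atTop hmono
  obtain ⟨n, hn⟩ := (hlim.eventually_const_lt hy).exists
  -- curve classes at distance `< 1/(n+1)` have a `ρ`-tube containing `s n`
  have hpos : (0 : ℝ) < 1 / ((n : ℝ) + 1) := by positivity
  filter_upwards [Metric.ball_mem_nhds c hpos] with c' hc'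
  refine hn.trans_le (measure_mono fun w hw => ?_)
  simp only [hs, mem_setOf_eq] at hw ⊢
  have hL := (lipschitzWith_infDist_range w).dist_le_mul c' c
  rw [NNReal.coe_one, one_mul, Real.dist_eq] at hL
  rw [mem_ball] at hc'
  have := (abs_le.1 hL).2
  linarith

/-- The curve classes with `ρ`-tube of volume `≤ M` form a closed set. [folklore] -/
theorem isClosed_setOf_measure_tube_le (ρ : ℝ) (M : ℝ≥0∞) :
    IsClosed {c : CurveClass E | vol {w | infDist w c.range < ρ} ≤ M} :=
  (lowerSemicontinuous_measure_tube vol ρ).isClosed_preimage M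

end Tube

/-! ### Expected tube volume versus pointwise hitting probabilities (Tonelli) -/

section Tonelli

variable {Ω' : Type*} [MeasurableSpace Ω'] {W : Measure Ω'} [SFinite W]

/-- `(w, ω) ↦ dist(w, trace Γ(ω))` is jointly measurable for a measurable random curve class
(continuous in `w`, measurable in `ω`). [folklore] -/
theorem measurable_infDist_range_uncurry {Γ : Ω' → CurveClass ℂ} (hΓ : Measurable Γ) :
    Measurable fun q : ℂ × Ω' => infDist q.1 (Γ q.2).range := by
  have h := measurable_uncurry_of_continuous_of_measurable
    (u := fun (w : ℂ) (ω : Ω') => infDist w (Γ ω).range)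
    (fun ω => continuous_infDist_pt _)
    (fun w => (lipschitzWith_infDist_range w).continuous.measurable.comp hΓ)
  exact h

/-- **Tonelli for tubes.** For a measurable random curve class `Γ` and any set `B ⊆ ℂ`:
`∫_B W[dist(w, trace Γ) < ρ] dw = E[vol({w : dist(w, trace Γ) < ρ} ∩ B)]`. [folklore] -/
theorem lintegral_measure_tube_eq {Γ : Ω' → CurveClass ℂ} (hΓ : Measurable Γ) (B : Set ℂ) (ρ : ℝ) :
    ∫⁻ w in B, W {ω | infDist w (Γ ω).range < ρ} =
      ∫⁻ ω, volume ({w | infDist w (Γ ω).range < ρ} ∩ B) ∂W := by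
  set S : Set (ℂ × Ω') := {q | infDist q.1 (Γ q.2).range < ρ} with hS
  have hSm : MeasurableSet S := measurable_infDist_range_uncurry hΓ measurableSet_Iio
  have h1 : ∫⁻ w in B, W {ω | infDist w (Γ ω).range < ρ} = ((volume.restrict B).prod W) S := by
    rw [Measure.prod_apply hSm]
    rfl
  have h2 : ((volume.restrict B).prod W) S = ∫⁻ ω, volume ({w | infDist w (Γ ω).range < ρ} ∩ B) ∂W := by
    rw [Measure.prod_apply_symm hSm]
    refine lintegral_congr fun ω => ?_
    have hm : MeasurableSet {w : ℂ | infDist w (Γ ω).range < ρ} :=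
      measurableSet_lt (continuous_infDist_pt _).measurable measurable_const
    show volume.restrict B {w | infDist w (Γ ω).range < ρ} = _
    rw [Measure.restrict_apply hm]
  rw [h1, h2]

end Tonelli

/-! ### The SLE side: a uniform lower bound for the hitting probabilities of small balls -/

section SLESide

/-- **A conformal map is Lipschitz near a compact set.** For a conformal equivalence `φ` on an
open set `U` and a compact `K ⊆ U` there are `r₁ > 0` and `L > 0` such that the balls
`B(z, r₁)`, `z ∈ K`, lie in `U` and `‖φ y - φ z‖ ≤ L ‖y - z‖` for `y ∈ B(z, r₁)` (the derivative
is continuous, hence bounded on a compact thickening of `K`). [folklore] -/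
theorem exists_lipschitz_near_of_conformalEquiv {U V : Set ℂ} (φ : ConformalEquiv U V) (hU : IsOpen U)
    {K : Set ℂ} (hK : IsCompact K) (hKU : K ⊆ U) :
    ∃ r₁ : ℝ, 0 < r₁ ∧ ∃ L : ℝ, 0 < L ∧ (∀ z ∈ K, ball z r₁ ⊆ U) ∧
      ∀ z ∈ K, ∀ y ∈ ball z r₁, ‖φ y - φ z‖ ≤ L * ‖y - z‖ := by
  obtain ⟨r₁, hr₁, hsub⟩ := hK.exists_cthickening_subset_open hU hKU
  have hK₁ : IsCompact (cthickening r₁ K) := hK.cthickening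
  have hcont : ContinuousOn (deriv φ) U :=
    ((φ.differentiableOn_coe.contDiffOn (n := 1) hU).continuousOn_deriv_of_isOpen hU le_rfl)
  obtain ⟨L₀, hL₀⟩ := hK₁.exists_bound_of_continuousOn (hcont.mono hsub)
  have hball : ∀ z ∈ K, ball z r₁ ⊆ cthickening r₁ K := fun z hz y hy =>
    mem_cthickening_of_dist_le y z r₁ K hz (mem_ball.1 hy).le
  refine ⟨r₁, hr₁, max L₀ 1, by positivity, fun z hz => (hball z hz).trans hsub, fun z hz y hy => ?_⟩
  exact (convex_ball z r₁).norm_image_sub_le_of_norm_deriv_le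
    (fun x hx => φ.differentiableOn_coe.differentiableAt (hU.mem_nhds (hsub (hball z hz hx))))
    (fun x hx => (hL₀ x (hball z hz hx)).trans (le_max_left _ _)) (mem_ball_self hr₁) hy

variable {κ : ℝ≥0} {D : DobrushinDomain} {Γ : (ℝ≥0 → ℝ) → CurveClass ℂ}

/-- **The SLE side.** For a chordal SLE_κ random curve `Γ` of `(D; a, b)`, `0 < κ < 8`, there is
a closed ball `B̄(w₀, r) ⊆ D` and constants `c > 0`, `L > 0`, `ρ₀ > 0` with
`P[dist(w, trace Γ) < ρ] ≥ c (ρ/L)^{1-κ/8}` for all `w ∈ B̄(w₀, r)` and `0 < ρ ≤ ρ₀`: Beffara's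
one-point lower estimate for the half-plane trace (`exists_onePoint_lower_of_isCompact`, proved in
the tree, with the trace existing by `hasSLETrace_of_ne_eight_apply`) on the compact set
`K = φ⁻¹(B̄(w₀, r))`, transported by the uniformizing map `φ`, which is Lipschitz near `K`.
[cite: Beffara2008, Prop. 4] -/
theorem exists_tube_lower_bound_of_isSLECurve (hκ0 : 0 < κ) (hκ8 : κ < 8) (hΓ : IsSLECurve κ D Γ) :
    ∃ (w₀ : ℂ) (r : ℝ), 0 < r ∧ ∃ c : ℝ≥0∞, c ≠ 0 ∧ ∃ L : ℝ, 0 < L ∧ ∃ ρ₀ : ℝ, 0 < ρ₀ ∧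
      ∀ ρ : ℝ, 0 < ρ → ρ ≤ ρ₀ → ∀ w ∈ closedBall w₀ r,
        c * ENNReal.ofReal ((ρ / L) ^ (1 - (κ : ℝ) / 8)) ≤
          Literature.Probability.Process.preWienerMeasure {ω | infDist w (Γ ω).range < ρ} := by
  obtain ⟨-, φ, -, hae⟩ := hΓ
  -- a closed ball in `D` and its compact preimage `K ⊆ ℍ`
  obtain ⟨w₀, hw₀⟩ := D.isConnected.nonempty
  obtain ⟨r', hr', hballD⟩ := Metric.isOpen_iff.1 D.isOpen w₀ hw₀
  set r : ℝ := r' / 2 with hr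
  have hr0 : 0 < r := by positivity
  have hsubD : closedBall w₀ r ⊆ D.carrier := (closedBall_subset_ball (by rw [hr]; linarith)).trans hballD
  set K : Set ℂ := φ.symm '' closedBall w₀ r with hK
  have hKc : IsCompact K :=
    (isCompact_closedBall w₀ r).image_of_continuousOn (φ.symm.continuousOn.mono hsubD)
  have hKU : K ⊆ upperHalfPlaneSet := by
    rintro _ ⟨w, hw, rfl⟩
    exact φ.symm_mapsTo (hsubD hw)
  obtain ⟨r₁, hr₁, L, hL, hballU, hlip⟩ := exists_lipschitz_near_of_conformalEquiv φ isOpen_upperHalfPlaneSet hKc hKU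
  obtain ⟨c₁, hc₁, ε₀, hε₀, hest⟩ :=
    exists_onePoint_lower_of_isCompact hκ0 hκ8 (hasSLETrace_of_ne_eight_apply hκ8.ne) K hKc hKU
  refine ⟨w₀, r, hr0, c₁, hc₁, 2 * L, by positivity, min (2 * L * ε₀) (L * r₁), by positivity,
    fun ρ hρ hρ₀ w hw => ?_⟩
  -- the point `z = φ⁻¹ w ∈ K` and the radius `ε = ρ / (2L)`
  set z : ℂ := φ.symm w with hz
  have hzK : z ∈ K := ⟨w, hw, rfl⟩
  have hφz : φ z = w := φ.apply_symm_apply (hsubD hw)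
  set ε : ℝ := ρ / (2 * L) with hε
  have hε0 : 0 < ε := by positivity
  have hεε₀ : ε ≤ ε₀ := by
    rw [hε, div_le_iff₀ (by positivity)]
    calc ρ ≤ 2 * L * ε₀ := hρ₀.trans (min_le_left _ _)
      _ = ε₀ * (2 * L) := by ring
  have h2ε : 2 * ε ≤ r₁ := by
    have h1 : ρ ≤ L * r₁ := hρ₀.trans (min_le_right _ _)
    rw [hε]
    rw [show 2 * (ρ / (2 * L)) = ρ / L by field_simp, div_le_iff₀ hL]
    linarith
  refine (hest ε hε0 hεε₀ z hzK).trans (measure_mono_ae ?_)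
  filter_upwards [hae] with ω hω hA
  obtain ⟨-, c, hΓω, hc⟩ := hω
  change infDist w (Γ ω).range < ρ
  have hA' : infDist z (range (sleTrace κ ω)) ≤ ε := hA
  -- a point of the half-plane trace within `2ε` of `z`
  have hlt : infDist z (range (sleTrace κ ω)) < 2 * ε := hA'.trans_lt (by linarith)
  obtain ⟨_, ⟨t, rfl⟩, hzy⟩ := (infDist_lt_iff (range_nonempty _)).1 hlt
  set y : ℂ := sleTrace κ ω t with hy
  have hyball : y ∈ ball z r₁ := mem_ball.2 (by rw [dist_comm]; exact hzy.trans_le h2ε)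
  have hyU : y ∈ upperHalfPlaneSet := hballU z hzK hyball
  -- its image lies on the trace of `Γ ω`
  obtain ⟨s, hs1, hst⟩ := exists_rayParam_eq t
  have hcs : c s = φ y := by
    rw [hc.1 s hs1, hst, ← hy, φ.boundaryExtension_eq hyU]
  have hmem : φ y ∈ (Γ ω).range := by
    rw [hΓω, CurveClass.range_mk]
    change φ y ∈ Set.range c
    exact ⟨s, hcs⟩
  -- and is within `ρ` of `w = φ z`
  calc infDist w (Γ ω).range ≤ dist w (φ y) := infDist_le_dist_of_mem hmem
    _ = ‖φ y - φ z‖ := by rw [dist_comm, dist_eq_norm, hφz]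
    _ ≤ L * ‖y - z‖ := hlip z hzK y hyball
    _ < L * (2 * ε) := by
        refine mul_lt_mul_of_pos_left ?_ hL
        rw [← dist_eq_norm, dist_comm]; exact hzy
    _ = ρ := by rw [hε]; field_simp

end SLESide

/-! ### Assembly: thin limits, and the left half of the fugacity barrier -/

section Assembly

/-- **Limits in law of short SAW families are thin.** If finite laws `P δ` on the SAWs of `Ω_δ`
from `A δ` to `B δ` give walks of more than `C/δ` steps probability `→ 0`, and the polylines
converge in law in the curve topology to a random curve class `Γ` under a finite measure `W`,
then for every `0 < ρ ≤ 1`, almost surely `vol{w : dist(w, trace Γ) < ρ} ≤ 9π(C+1)ρ`: the set of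
curve classes with this property is closed (`isClosed_setOf_measure_tube_le`) and contains the
polyline of every walk of `≤ C/δ` steps once `δ ≤ ρ` (`volume_setOf_infDist_lt_le_of_length_le`);
closed-set half of the portmanteau theorem (`ae_mem_of_tendstoLaw_of_isClosed`). This is the
mirror image of "limits of weakly space-filling families are onto" (`…ProofsNarrow`).
[cite: Billingsley1999, Thm 2.1] -/
theorem ae_measure_tube_le_of_tendstoLaw {Ω : Set ℂ} {A B : ℝ → Site 2}
    {P : ∀ δ, Measure (DomainSAW Ω δ (A δ) (B δ))} [∀ δ, IsFiniteMeasure (P δ)]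
    {Ω' : Type*} [MeasurableSpace Ω'] {W : Measure Ω'} [IsFiniteMeasure W]
    {Γ : Ω' → CurveClass ℂ} (hΓ : AEMeasurable Γ W)
    (hT : TendstoLaw (fun δ (γ : DomainSAW Ω δ (A δ) (B δ)) => γ.curve) P Γ W)
    {C : ℝ} (hC : 0 ≤ C) (hshort : Tendsto (fun δ => P δ {γ | C / δ < γ.length}) (𝓝[>] 0) (𝓝 0))
    {ρ : ℝ} (hρ : 0 < ρ) (hρ1 : ρ ≤ 1) :
    ∀ᵐ ω ∂W, volume {w | infDist w (Γ ω).range < ρ} ≤ ENNReal.ofReal (9 * Real.pi * (C + 1) * ρ) := by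
  set M : ℝ≥0∞ := ENNReal.ofReal (9 * Real.pi * (C + 1) * ρ) with hM
  have hF := isClosed_setOf_measure_tube_le (E := ℂ) volume ρ M
  refine ae_mem_of_tendstoLaw_of_isClosed (F := {c : CurveClass ℂ | volume {w | infDist w c.range < ρ} ≤ M})
    (fun δ => DomainSAW.measurable_of_top _) hΓ hT hF ?_
  refine tendsto_of_tendsto_of_tendsto_of_le_of_le' tendsto_const_nhds hshort
    (Eventually.of_forall fun δ => by simp) ?_
  filter_upwards [Ioc_mem_nhdsGT hρ] with δ hδ
  refine measure_mono fun γ hγ => ?_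
  change ¬ volume {w | infDist w γ.curve.range < ρ} ≤ M at hγ
  change C / δ < (γ.length : ℝ)
  by_contra hlen
  exact hγ (volume_setOf_infDist_lt_le_of_length_le hδ.1 hδ.2 hρ1 hC γ (not_lt.1 hlen))

variable {κ : ℝ≥0} {D : DobrushinDomain} {A B : ℝ → Site 2}

/-- **Short SAW families converge to no chordal SLE_κ, `0 < κ < 8`.** If finite laws `P δ` on the
SAWs of `Ω_δ` (`Ω = D.carrier`) give walks of more than `C/δ` steps probability `→ 0`, the
polylines do not converge in law to chordal SLE_κ in `(D; a, b)` for any `0 < κ < 8`. A limit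
`Γ` would be thin (`ae_measure_tube_le_of_tendstoLaw`: `E[vol(B̄ ∩ {dist(·, trace Γ) < ρ})] ≤ 9π(C+1)ρ`)
whereas the SLE side (`exists_tube_lower_bound_of_isSLECurve`) and Tonelli
(`lintegral_measure_tube_eq`) give `E[vol(B̄(w₀,r) ∩ {dist(·, trace Γ) < ρ})] ≥ c (ρ/L)^{1-κ/8} · πr²`;
as `ρ → 0⁺` the exponent `1 - κ/8 < 1` wins. [cite: Beffara2008, Prop. 4] -/
theorem not_convergesInLawToSLE_of_short (hκ0 : 0 < κ) (hκ8 : κ < 8)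
    {P : ∀ δ, Measure (DomainSAW D.carrier δ (A δ) (B δ))} (hP : ∀ δ, IsFiniteMeasure (P δ))
    {C : ℝ} (hC : 0 ≤ C) (hshort : Tendsto (fun δ => P δ {γ | C / δ < γ.length}) (𝓝[>] 0) (𝓝 0)) :
    ¬ ConvergesInLawToSLE κ D (fun δ (γ : DomainSAW D.carrier δ (A δ) (B δ)) => γ.curve) P := by
  haveI := hP
  rintro ⟨Γ, hΓ, -, hT⟩
  haveI : IsProbabilityMeasure Literature.Probability.Process.preWienerMeasure :=
    isProbabilityMeasure_preWienerMeasure'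
  obtain ⟨w₀, r, hr, c, hc, L, hL, ρ₀, hρ₀, hlow⟩ := exists_tube_lower_bound_of_isSLECurve hκ0 hκ8 hΓ
  set W : Measure (ℝ≥0 → ℝ) := Literature.Probability.Process.preWienerMeasure with hW
  set a : ℝ := 1 - (κ : ℝ) / 8 with ha
  have ha1 : a - 1 < 0 := by
    have : (0 : ℝ) < κ := by exact_mod_cast hκ0
    rw [ha]; linarith
  -- a finite positive constant `c' ≤ c`
  set c' : ℝ≥0∞ := min c 1 with hc'
  have hc'0 : c' ≠ 0 := by
    rw [hc']; exact (lt_min (pos_iff_ne_zero.2 hc) one_pos).ne'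
  have hc'top : c' ≠ ⊤ := ne_top_of_le_ne_top ENNReal.one_ne_top (min_le_right _ _)
  set c₀ : ℝ := c'.toReal with hc₀
  have hc₀0 : 0 < c₀ := ENNReal.toReal_pos hc'0 hc'top
  have hc'eq : c' = ENNReal.ofReal c₀ := (ENNReal.ofReal_toReal hc'top).symm
  -- the measurable modification of `Γ`
  set Γ' : (ℝ≥0 → ℝ) → CurveClass ℂ := hΓ.aemeasurable.mk Γ with hΓ'
  have hΓ'm : Measurable Γ' := hΓ.aemeasurable.measurable_mk
  have hΓΓ' : Γ =ᵐ[W] Γ' := hΓ.aemeasurable.ae_eq_mk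
  have hpi : (NNReal.pi : ℝ≥0∞) = ENNReal.ofReal Real.pi := by
    rw [← ENNReal.ofReal_coe_nnreal, NNReal.coe_real_pi]
  -- the key inequality for every small `ρ`
  have key : ∀ ρ : ℝ, 0 < ρ → ρ ≤ min ρ₀ 1 →
      c₀ * (ρ / L) ^ a * (r ^ 2 * Real.pi) ≤ 9 * Real.pi * (C + 1) * ρ := by
    intro ρ hρ hρm
    have hthin := ae_measure_tube_le_of_tendstoLaw hΓ.aemeasurable hT hC hshort hρ
      (hρm.trans (min_le_right _ _))
    have hthin' : ∀ᵐ ω ∂W, volume {w | infDist w (Γ' ω).range < ρ} ≤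
        ENNReal.ofReal (9 * Real.pi * (C + 1) * ρ) := by
      filter_upwards [hthin, hΓΓ'] with ω h1 h2
      rwa [← h2]
    have hlow' : ∀ w ∈ closedBall w₀ r,
        c' * ENNReal.ofReal ((ρ / L) ^ a) ≤ W {ω | infDist w (Γ' ω).range < ρ} := by
      intro w hw
      calc c' * ENNReal.ofReal ((ρ / L) ^ a) ≤ c * ENNReal.ofReal ((ρ / L) ^ a) :=
            mul_le_mul' (min_le_left _ _) le_rfl
        _ ≤ W {ω | infDist w (Γ ω).range < ρ} := hlow ρ hρ (hρm.trans (min_le_left _ _)) w hw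
        _ ≤ W {ω | infDist w (Γ' ω).range < ρ} := by
            refine measure_mono_ae ?_
            filter_upwards [hΓΓ'] with ω hω h
            change infDist w (Γ' ω).range < ρ
            rw [← hω]; exact h
    have hE : c' * ENNReal.ofReal ((ρ / L) ^ a) * volume (closedBall w₀ r) ≤
        ENNReal.ofReal (9 * Real.pi * (C + 1) * ρ) := by
      calc c' * ENNReal.ofReal ((ρ / L) ^ a) * volume (closedBall w₀ r)
          = ∫⁻ _ in closedBall w₀ r, c' * ENNReal.ofReal ((ρ / L) ^ a) := (setLIntegral_const _ _).symm
        _ ≤ ∫⁻ w in closedBall w₀ r, W {ω | infDist w (Γ' ω).range < ρ} :=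
            setLIntegral_mono' measurableSet_closedBall fun w hw => hlow' w hw
        _ = ∫⁻ ω, volume ({w | infDist w (Γ' ω).range < ρ} ∩ closedBall w₀ r) ∂W :=
            lintegral_measure_tube_eq hΓ'm _ _
        _ ≤ ∫⁻ _, ENNReal.ofReal (9 * Real.pi * (C + 1) * ρ) ∂W := by
            refine lintegral_mono_ae ?_
            filter_upwards [hthin'] with ω hω
            exact (measure_mono inter_subset_left).trans hω
        _ = ENNReal.ofReal (9 * Real.pi * (C + 1) * ρ) := by
            rw [lintegral_const, measure_univ, mul_one]
    -- back to real numbers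
    rw [Complex.volume_closedBall, hc'eq, hpi, ← ENNReal.ofReal_pow hr.le,
      ← ENNReal.ofReal_mul hc₀0.le, ← ENNReal.ofReal_mul (sq_nonneg r),
      ← ENNReal.ofReal_mul (by positivity)] at hE
    have := (ENNReal.ofReal_le_ofReal_iff (by positivity)).1 hE
    linarith [this]
  -- `ρ^{a-1} ≤ A` for small `ρ`, impossible since `a - 1 < 0`
  set A₀ : ℝ := 9 * Real.pi * (C + 1) * L ^ a / (c₀ * (r ^ 2 * Real.pi)) with hA₀
  have hev1 : ∀ᶠ ρ in 𝓝[>] (0 : ℝ), A₀ < ρ ^ (a - 1) :=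
    (tendsto_rpow_neg_nhdsGT_zero ha1).eventually_gt_atTop A₀
  have hev2 : ∀ᶠ ρ in 𝓝[>] (0 : ℝ), ρ ∈ Ioc 0 (min ρ₀ 1) := Ioc_mem_nhdsGT (by positivity)
  obtain ⟨ρ, hρA, hρ0, hρm⟩ := (hev1.and hev2).exists
  have hkey := key ρ hρ0 hρm
  have hLa : 0 < L ^ a := Real.rpow_pos_of_pos hL _
  have hden : 0 < c₀ * (r ^ 2 * Real.pi) := by positivity
  -- `c₀ (ρ/L)^a r²π ≤ 9π(C+1) ρ` gives `ρ^{a-1} ≤ A₀`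
  have h1 : ρ ^ a ≤ A₀ * ρ := by
    rw [Real.div_rpow hρ0.le hL.le] at hkey
    rw [hA₀]
    rw [div_mul_eq_mul_div, le_div_iff₀ hden]
    have h2 : c₀ * (ρ ^ a / L ^ a) * (r ^ 2 * Real.pi) * L ^ a = ρ ^ a * (c₀ * (r ^ 2 * Real.pi)) := by
      field_simp
    nlinarith [mul_le_mul_of_nonneg_right hkey hLa.le, h2]
  have h3 : ρ ^ (a - 1) ≤ A₀ := by
    rw [Real.rpow_sub_one hρ0.ne', div_le_iff₀ hρ0]
    exact h1
  exact absurd h3 (not_le.2 hρA)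

/-- **The fugacity-`x` SAW in the unit disc, `0 < x < x_c`, converges to no chordal SLE_κ with
`0 < κ < 8`** (any endpoints `A δ, B δ ∈ 𝔻_δ`): subcritical walks are short
(`tendsto_lawAt_length_lt_of_lt_criticalFugacity`) and short families converge to no such SLE
(`not_convergesInLawToSLE_of_short`). The LEFT counterpart of
`not_convergesInLawToSLE_supercritical_unitDisc_of_lt_eight` (`…BelowEight`, every `x > x_c`).
[cite: DuminilCopinKozmaYadin2014, §1 (When x < 1/μ)] -/
theorem not_convergesInLawToSLE_subcritical_unitDisc_of_lt_eight {x : ℝ} (hx0 : 0 < x)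
    (hxc : x < criticalFugacity) (hκ0 : 0 < κ) (hκ8 : κ < 8)
    (hAB : ∀ δ : ℝ, 0 < δ → A δ ∈ meshDomain unitDisk δ ∧ B δ ∈ meshDomain unitDisk δ) :
    ¬ ConvergesInLawToSLE κ DobrushinDomain.unitDisc
        (fun δ (γ : DomainSAW DobrushinDomain.unitDisc.carrier δ (A δ) (B δ)) => γ.curve)
        (fun δ => lawAt x DobrushinDomain.unitDisc.carrier δ (A δ) (B δ)) := by
  obtain ⟨C, hC, hshort⟩ := tendsto_lawAt_length_lt_of_lt_criticalFugacity hx0 hxc hAB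
  -- `DobrushinDomain.unitDisc.carrier = unitDisk` definitionally (`carrier_unitDisc`)
  exact not_convergesInLawToSLE_of_short (D := DobrushinDomain.unitDisc) hκ0 hκ8
    (P := fun δ => lawAt x unitDisk δ (A δ) (B δ))
    (fun δ => isFiniteMeasure_lawAt x unitDisk δ (A δ) (B δ)) hC.le hshort

/-- **`¬ SAWScalingLimitAt x` for every `0 < x < x_c`** (closest-site endpoints of `(𝔻; 1, -1)`,
`isEndpointApprox_unitDisc_of_isClosestSite`): the left counterpart of
`not_sawScalingLimitAt_of_lt` (`…Unconditional`, every `x > x_c`).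
[cite: DuminilCopinKozmaYadin2014, §1 (When x < 1/μ)] -/
theorem not_sawScalingLimitAt_of_lt_criticalFugacity {x : ℝ} (hx0 : 0 < x) (hxc : x < criticalFugacity) :
    ¬ SAWScalingLimitAt x := by
  obtain ⟨A, hA⟩ := exists_closestSiteFamily (1 : ℂ)
  obtain ⟨B, hB⟩ := exists_closestSiteFamily (-1 : ℂ)
  have hAB : ∀ δ : ℝ, 0 < δ →
      IsClosestSite unitDisk δ 1 (A δ) ∧ IsClosestSite unitDisk δ (-1) (B δ) :=
    fun δ hδ => ⟨hA δ hδ, hB δ hδ⟩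
  intro h
  exact not_convergesInLawToSLE_subcritical_unitDisc_of_lt_eight (κ := (8 : ℝ≥0) / 3) hx0 hxc
    (by positivity) (by rw [div_lt_iff₀ (by norm_num : (0 : ℝ≥0) < 3)]; norm_num)
    (fun δ hδ => ⟨(hA δ hδ).1, (hB δ hδ).1⟩)
    (h DobrushinDomain.unitDisc A B (isEndpointApprox_unitDisc_of_isClosestSite hAB))

/-- **The SLE_{8/3} identification pins the fugacity exactly.** For `x > 0`:
`SAWScalingLimitAt x → x = x_c` — the right half `x ≤ x_c` is
`le_criticalFugacity_of_sawScalingLimitAt` (`…ProofsOnto`, from Theorem 1 of the source), the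
left half is `not_sawScalingLimitAt_of_lt_criticalFugacity`. [cite: DuminilCopinKozmaYadin2014, §1] -/
theorem eq_criticalFugacity_of_sawScalingLimitAt {x : ℝ} (hx0 : 0 < x) (h : SAWScalingLimitAt x) :
    x = criticalFugacity := by
  rcases lt_trichotomy x criticalFugacity with hlt | heq | hgt
  · exact absurd h (not_sawScalingLimitAt_of_lt_criticalFugacity hx0 hlt)
  · exact heq
  · exact absurd h (not_sawScalingLimitAt_of_lt hgt)

/-- For `x > 0`, `SAWScalingLimitAt x` holds iff `x = x_c` and the sub-problem
`SAWScalingLimit` holds. [cite: DuminilCopinKozmaYadin2014, §1] -/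
theorem sawScalingLimitAt_iff_of_pos {x : ℝ} (hx0 : 0 < x) :
    SAWScalingLimitAt x ↔ x = criticalFugacity ∧ SAWScalingLimit := by
  constructor
  · intro h
    have hx := eq_criticalFugacity_of_sawScalingLimitAt hx0 h
    subst hx
    exact ⟨rfl, sawScalingLimitAt_criticalFugacity.1 h⟩
  · rintro ⟨rfl, h⟩
    exact sawScalingLimitAt_criticalFugacity.2 h

/-- **Every LEFT-robust class is refuted**: for every `ε > 0` it is false that
`SAWScalingLimitAt x` holds for all `x ∈ (x_c - ε, x_c]` (the point
`x = x_c - min (ε/2) (x_c/2)` fails). With `not_forall_Ico_sawScalingLimitAt` (`…ProofsOnto`) both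
one-sided robust classes are now refuted by declarations of the tree.
[cite: DuminilCopinKozmaYadin2014, §1] -/
theorem not_forall_Ioc_sawScalingLimitAt {ε : ℝ} (hε : 0 < ε) :
    ¬ ∀ x ∈ Set.Ioc (criticalFugacity - ε) criticalFugacity, SAWScalingLimitAt x := by
  intro h
  have hxc := criticalFugacity_pos
  set x : ℝ := criticalFugacity - min (ε / 2) (criticalFugacity / 2) with hx
  have hmin0 : 0 < min (ε / 2) (criticalFugacity / 2) := lt_min (by linarith) (by linarith)
  have hx0 : 0 < x := by
    have := min_le_right (ε / 2) (criticalFugacity / 2)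
    rw [hx]; linarith
  have hxlt : x < criticalFugacity := by rw [hx]; linarith
  have hxmem : x ∈ Set.Ioc (criticalFugacity - ε) criticalFugacity := by
    refine ⟨?_, hxlt.le⟩
    have := min_le_left (ε / 2) (criticalFugacity / 2)
    rw [hx]; linarith
  exact not_sawScalingLimitAt_of_lt_criticalFugacity hx0 hxlt (h x hxmem)

/-- **No two-sided, one-sided or punctured robust class survives**: for `x > 0`, `x ≠ x_c`,
`¬ SAWScalingLimitAt x`. [cite: DuminilCopinKozmaYadin2014, §1] -/
theorem not_sawScalingLimitAt_of_ne {x : ℝ} (hx0 : 0 < x) (hne : x ≠ criticalFugacity) :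
    ¬ SAWScalingLimitAt x :=
  fun h => hne (eq_criticalFugacity_of_sawScalingLimitAt hx0 h)

end Assembly

end SupercriticalSAW

open SupercriticalSAW

/-! ### The audited barrier (fifth audit): both halves of the fugacity axis -/

/-- **Barrier `SupercriticalSAWSpaceFillingSubcritical`** (fifth audit of the mechanism of
`SupercriticalSAWSpaceFilling`; PROVED below, `SupercriticalSAWSpaceFillingSubcritical_holds`):
Theorem 1 of Duminil-Copin–Kozma–Yadin together with its LEFT counterpart on limit laws — for
`0 < x < x_c` the fugacity-`x` SAW of `(𝔻; 1, -1)` converges to no chordal SLE_κ, `0 < κ < 8`,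
because subcritical walks have `O(1/δ)` steps and limits of such families are thin, whereas an
SLE_κ trace (`κ < 8`) is not — so that the SLE_{8/3} identification holds at NO positive fugacity
other than `x_c = 1/μ(ℤ²)` itself: `SAWScalingLimitAt x → x = x_c`.

BARRIER (structured block, D-0021):
- technique_class: that of `SupercriticalSAWSpaceFilling` (fugacity-robust, δ-uniform conclusions about the curve-topology limit of the fugacity-`x` SAW), now on BOTH sides of `x_c` and for PUNCTURED classes: any argument whose conclusion — identification of the limit in law with a chordal SLE_κ, `0 < κ < 8`, in the topology `d` of curves modulo reparametrisation — would hold at some fugacity `x > 0` other than the point `x_c = 1/μ(ℤ²)` (two-sided neighbourhoods, left classes `(x_c - ε, x_c]`, right classes `[x_c, x_c + ε)`, or one explicit `x` not known to equal `1/μ(ℤ²)`) [cite: DuminilCopinKozmaYadin2014, §1]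
- blocks: everything the base barrier blocks, and (proved here) `∀ x ∈ (x_c - ε, x_c], SAWScalingLimitAt x` for every `ε > 0` (`SupercriticalSAW.not_forall_Ioc_sawScalingLimitAt`); `SAWScalingLimitAt x` for every `0 < x ≠ x_c` (`SupercriticalSAW.not_sawScalingLimitAt_of_ne`, with `SupercriticalSAW.not_sawScalingLimitAt_of_lt` of `…Unconditional` for the right half); in the unit disc with ANY endpoints `u_δ, v_δ ∈ 𝔻_δ`, convergence of the fugacity-`x` laws, `0 < x < x_c`, to ANY chordal SLE_κ with `0 < κ < 8` (`SupercriticalSAW.not_convergesInLawToSLE_subcritical_unitDisc_of_lt_eight`); more generally convergence to such an SLE, in any Dobrushin domain, of any family of finite laws on SAWs whose walks have more than `C/δ` steps with probability `→ 0` (`SupercriticalSAW.not_convergesInLawToSLE_of_short`) — e.g. fugacity laws additionally tilted or conditioned towards short walks; consequence (`SupercriticalSAW.eq_criticalFugacity_of_sawScalingLimitAt`, `SupercriticalSAW.sawScalingLimitAt_iff_of_pos`): for `x > 0`, `SAWScalingLimitAt x ↔ (x = x_c ∧ SAWScalingLimit)`, i.e. an SLE_{8/3} identification at an explicit fugacity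 `x` is a determination `μ(ℤ²) = 1/x` of the connective constant, for which "no closed formula exists in general" [cite: DuminilCopinKozmaYadin2014, §1]
- because: for `x < 1/μ` the counts satisfy `cₙ xⁿ ≤ K ρⁿ` with `ρ < 1` (`μ = inf cₙ^{1/n}`, `c_{n+m} ≤ cₙ cₘ` [cite: MadrasSlade1993, §1.2]) while `Z ≥ x^{4/δ}` (one lattice path through the centre of the disc), so `P[|γ_δ| > C/δ] ≤ K' e^{-c/δ}` once `C log(1/ρ) > 4 log(1/x)`: the polyline has macroscopic length `≤ C` and `ρ`-tube volume `≤ 9π(C+1)ρ`, a closed condition on curve classes (the tube volume is lower semicontinuous) that passes to every limit in law [cite: Billingsley1999, Thm 2.1]; but a chordal SLE_κ curve, `κ < 8`, comes within `ε` of each point of a compact interior set with probability `≥ c₁ ε^{1-κ/8}` [cite: Beffara2008, Prop. 4] (proved in the tree, trace existence [cite: RohdeSchramm2005, Thm 5.1]), uniformly after transport by the uniformizing map (Lipschitz near compacts), whence by Tonelli an expected tube volume `≥ c ρ^{1-κ/8} π r² ≫ ρ` as `ρ → 0`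
- evasions_known: none for the obstructed conclusion (SLE_κ, `κ < 8`, at a fugacity `≠ x_c`); NOT obstructed, as catalogued in the base block and the earlier audits: (i) mesh-coordinated windows `x(δ) → x_c` (on the left as on the right: `C(x) → ∞` as `x ↑ x_c`, and windows `o(δ²)` are equivalent to the sub-problem, `…Narrow`), (ii) hypotheses, identities and observables open or analytic in `x` (only `x`-robust CONCLUSIONS are obstructed), (iv) prefix / driving-function / Carathéodory-level conclusions, (v) canonical fixed-length and half-plane kinetic ensembles — the conditional law given `|γ| = n` does not depend on `x` at all, (vi) robustness in a model parameter along a critical manifold, (vii) conclusions compatible with the degenerate limits — on the LEFT: convergence to the geodesic / straight segment with Gaussian `√δ` fluctuations, the expected truth [cite: DuminilCopinKozmaYadin2014, §1 (When x < 1/μ)] [cite: BetzTaggi2019, §1]; on the right: onto / SLE₈-type conclusions (`…ProofsOnto`)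
- scope_caveats: the left half is proved through the length bound only and does not identify the subcritical limit (the geodesic picture has no machine-checked proof; in print it is "implicit" in Ioffe (1998) and worked out in Kovchegov's thesis for boxes [cite: BetzTaggi2019, §1], the source being "not aware of a reference for the details" [cite: DuminilCopinKozmaYadin2014, §1 (When x < 1/μ)]); fugacities `x ≤ 0` are junk for `lawAt` (`ENNReal.ofReal` truncates signed weights) and are not covered; limits SLE_κ with `κ ≥ 8` at `x < x_c` are excluded in substance (thin limits are not onto) but the declarations are for `0 < κ < 8`; the lattice input is proved for the unit disc (the SLE side and `not_convergesInLawToSLE_of_short` hold in every Dobrushin domain); nothing here bears on the critical law itself — at `x_c` the walk is expected to be neither thin nor onto (`|γ_δ| ≍ δ^{-4/3}`), and both "not onto" (Problem 10 [cite: DuminilCopinKozmaYadin2014, Problem 10]) and a machine-checked "not thin" are open in the tree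
- status: established (proved in the tree: `SupercriticalSAWSpaceFillingSubcritical_holds`, axioms `propext`, `Classical.choice`, `Quot.sound`); audit gen 5 of `…Proofs` 2026-08-16: CONFIRMED at page level [cite: DuminilCopinKozmaYadin2014, §1 and Theorem 1] and STRENGTHENED — the last "refuted by no declaration" caveat of the catalogue entry (left classes) is discharged

[cite: DuminilCopinKozmaYadin2014, Theorem 1] -/
def SupercriticalSAWSpaceFillingSubcritical : Prop :=
  SupercriticalSAWSpaceFilling ∧
    ∀ x : ℝ, 0 < x → SupercriticalSAW.SAWScalingLimitAt x → x = criticalFugacity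

/-- **The audited barrier holds**: Theorem 1 is `SupercriticalSAWSpaceFilling_holds`
(`…TilesTheorem6`), the pinning clause is `eq_criticalFugacity_of_sawScalingLimitAt`.
[cite: DuminilCopinKozmaYadin2014, Theorem 1] -/
theorem SupercriticalSAWSpaceFillingSubcritical_holds : SupercriticalSAWSpaceFillingSubcritical :=
  ⟨SupercriticalSAWSpaceFilling_holds, fun _ hx h => eq_criticalFugacity_of_sawScalingLimitAt hx h⟩

end Literature.Barriers.CriticalPhenomena
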